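import Summits.Ventures.PercRepro.SevenThreeSmallPlanesFrame

/-!
# PercRepro — the `(7,3)` cell, (R6) part (f5): `K₄` (night-3, gen 4)

A plane `G` on `6` points with four three-point lines `ℓ₁, …, ℓ₄`, pairwise meeting in one point, any three covering
`G` (the chain's `NightThree.KFour`): `λ(B) = Σ_i [ℓ_i ⊆ B]`, four-indicator inclusion–exclusion gives the profile
`16×(3,0) + 12×(4,1) + 3×(4,0) + 6×(5,2) + (6,4)`, and the cells `cell_kFour_t*` the per-plane inequality
(`perPlane_kFour`).  Axioms: standard.
-/

namespace PercRepro

namespace SevenThree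

open Finset ThmH SixThree PerFlat

variable {α : Type*} [DecidableEq α] {M : Matroid α} [M.Finite]

/-- The rank-`2` triples of `K₄` inside `B` are its lines contained in `B`. -/
theorem lam3_eq_of_kFour {G ℓ₁ ℓ₂ ℓ₃ ℓ₄ : Finset α} (h1 : ℓ₁.card = 3) (h2 : ℓ₂.card = 3) (h3 : ℓ₃.card = 3)
    (h4 : ℓ₄.card = 3) (r1 : M.eRk (ℓ₁ : Set α) = 2) (r2 : M.eRk (ℓ₂ : Set α) = 2) (r3 : M.eRk (ℓ₃ : Set α) = 2)
    (r4 : M.eRk (ℓ₄ : Set α) = 2) (n12 : ℓ₁ ≠ ℓ₂) (n13 : ℓ₁ ≠ ℓ₃) (n14 : ℓ₁ ≠ ℓ₄) (n23 : ℓ₂ ≠ ℓ₃) (n24 : ℓ₂ ≠ ℓ₄)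
    (n34 : ℓ₃ ≠ ℓ₄)
    (hfree : ∀ T ∈ G.powersetCard 3, T ≠ ℓ₁ → T ≠ ℓ₂ → T ≠ ℓ₃ → T ≠ ℓ₄ → M.Indep (T : Set α)) {B : Finset α}
    (hB : B ⊆ G) :
    lam3 M B = (if ℓ₁ ⊆ B then 1 else 0) + (if ℓ₂ ⊆ B then 1 else 0) + (if ℓ₃ ⊆ B then 1 else 0) +
      (if ℓ₄ ⊆ B then 1 else 0) := by
  unfold lam3
  have hset : (B.powersetCard 3).filter (fun T : Finset α => M.eRk (T : Set α) = 2) =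
      (if ℓ₁ ⊆ B then {ℓ₁} else ∅) ∪ (if ℓ₂ ⊆ B then {ℓ₂} else ∅) ∪ (if ℓ₃ ⊆ B then {ℓ₃} else ∅) ∪
        (if ℓ₄ ⊆ B then {ℓ₄} else ∅) := by
    ext T
    rw [Finset.mem_filter, Finset.mem_powersetCard, Finset.mem_union, Finset.mem_union, Finset.mem_union]
    constructor
    · rintro ⟨⟨hTB, hT3⟩, hr⟩
      by_cases e1 : T = ℓ₁
      · subst e1; left; left; left; rw [if_pos hTB]; exact Finset.mem_singleton_self T
      by_cases e2 : T = ℓ₂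
      · subst e2; left; left; right; rw [if_pos hTB]; exact Finset.mem_singleton_self T
      by_cases e3 : T = ℓ₃
      · subst e3; left; right; rw [if_pos hTB]; exact Finset.mem_singleton_self T
      by_cases e4 : T = ℓ₄
      · subst e4; right; rw [if_pos hTB]; exact Finset.mem_singleton_self T
      exfalso
      have hind := hfree T (Finset.mem_powersetCard.2 ⟨hTB.trans hB, hT3⟩) e1 e2 e3 e4
      rw [hind.eRk_eq_encard, Set.encard_coe_eq_coe_finsetCard, hT3] at hr
      exact absurd hr (by decide)
    · rintro (((hT | hT) | hT) | hT)
      · by_cases h : ℓ₁ ⊆ B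
        · rw [if_pos h, Finset.mem_singleton] at hT; subst hT; exact ⟨⟨h, h1⟩, r1⟩
        · rw [if_neg h] at hT; exact absurd hT (Finset.notMem_empty T)
      · by_cases h : ℓ₂ ⊆ B
        · rw [if_pos h, Finset.mem_singleton] at hT; subst hT; exact ⟨⟨h, h2⟩, r2⟩
        · rw [if_neg h] at hT; exact absurd hT (Finset.notMem_empty T)
      · by_cases h : ℓ₃ ⊆ B
        · rw [if_pos h, Finset.mem_singleton] at hT; subst hT; exact ⟨⟨h, h3⟩, r3⟩
        · rw [if_neg h] at hT; exact absurd hT (Finset.notMem_empty T)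
      · by_cases h : ℓ₄ ⊆ B
        · rw [if_pos h, Finset.mem_singleton] at hT; subst hT; exact ⟨⟨h, h4⟩, r4⟩
        · rw [if_neg h] at hT; exact absurd hT (Finset.notMem_empty T)
  rw [hset]
  have hc : ∀ (ℓ : Finset α) (p : Prop) [Decidable p], (if p then ({ℓ} : Finset (Finset α)) else ∅).card =
      if p then 1 else 0 := by
    intro ℓ p _
    split_ifs <;> simp
  have hd12 : Disjoint (if ℓ₁ ⊆ B then ({ℓ₁} : Finset (Finset α)) else ∅) (if ℓ₂ ⊆ B then {ℓ₂} else ∅) := by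
    split_ifs <;> simp [n12]
  have hd3 : Disjoint ((if ℓ₁ ⊆ B then ({ℓ₁} : Finset (Finset α)) else ∅) ∪ (if ℓ₂ ⊆ B then {ℓ₂} else ∅))
      (if ℓ₃ ⊆ B then {ℓ₃} else ∅) := by
    rw [Finset.disjoint_union_left]
    constructor <;> split_ifs <;> simp [n13, n23]
  have hd4 : Disjoint ((if ℓ₁ ⊆ B then ({ℓ₁} : Finset (Finset α)) else ∅) ∪ (if ℓ₂ ⊆ B then {ℓ₂} else ∅) ∪
      (if ℓ₃ ⊆ B then {ℓ₃} else ∅)) (if ℓ₄ ⊆ B then {ℓ₄} else ∅) := by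
    rw [Finset.disjoint_union_left, Finset.disjoint_union_left]
    refine ⟨⟨?_, ?_⟩, ?_⟩ <;> split_ifs <;> simp [n14, n24, n34]
  rw [Finset.card_union_of_disjoint hd4, Finset.card_union_of_disjoint hd3, Finset.card_union_of_disjoint hd12,
    hc, hc, hc, hc]

omit [M.Finite] in
/-- A subset with `≥ 5` points of a four-line plane contains an independent triple (ten triples of any `5`-subset,
at most four lines); a `4`-subset as well (four triples, at most one line: two lines span `5` points). -/
theorem exists_indep_triple_of_four_kFour {G ℓ₁ ℓ₂ ℓ₃ ℓ₄ B : Finset α}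
    (u12 : (ℓ₁ ∪ ℓ₂).card = 5) (u13 : (ℓ₁ ∪ ℓ₃).card = 5) (u14 : (ℓ₁ ∪ ℓ₄).card = 5) (u23 : (ℓ₂ ∪ ℓ₃).card = 5)
    (u24 : (ℓ₂ ∪ ℓ₄).card = 5) (u34 : (ℓ₃ ∪ ℓ₄).card = 5)
    (hfree : ∀ T ∈ G.powersetCard 3, T ≠ ℓ₁ → T ≠ ℓ₂ → T ≠ ℓ₃ → T ≠ ℓ₄ → M.Indep (T : Set α)) (hB : B ⊆ G)
    (hB4 : 4 ≤ B.card) : ∃ T ⊆ B, T.card = 3 ∧ M.Indep (T : Set α) := by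
  obtain ⟨B₄, hB₄B, hB₄4⟩ := Finset.exists_subset_card_eq hB4
  have h4 : (B₄.powersetCard 3).card = 4 := by rw [Finset.card_powersetCard, hB₄4]; decide
  -- at most one line inside `B₄`
  have hone : ((B₄.powersetCard 3) ∩ {ℓ₁, ℓ₂, ℓ₃, ℓ₄}).card ≤ 1 := by
    rw [Finset.card_le_one]
    intro L hL L' hL'
    rw [Finset.mem_inter, Finset.mem_powersetCard] at hL hL'
    by_contra hne
    have hu : (L ∪ L').card ≤ 4 := by
      rw [← hB₄4]; exact Finset.card_le_card (Finset.union_subset hL.1.1 hL'.1.1)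
    have hmem := hL.2
    have hmem' := hL'.2
    simp only [Finset.mem_insert, Finset.mem_singleton] at hmem hmem'
    rcases hmem with rfl | rfl | rfl | rfl <;> rcases hmem' with rfl | rfl | rfl | rfl <;>
      first
      | exact hne rfl
      | (rw [u12] at hu; omega) | (rw [u13] at hu; omega) | (rw [u14] at hu; omega)
      | (rw [u23] at hu; omega) | (rw [u24] at hu; omega) | (rw [u34] at hu; omega)
      | (rw [Finset.union_comm, u12] at hu; omega) | (rw [Finset.union_comm, u13] at hu; omega)
      | (rw [Finset.union_comm, u14] at hu; omega) | (rw [Finset.union_comm, u23] at hu; omega)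
      | (rw [Finset.union_comm, u24] at hu; omega) | (rw [Finset.union_comm, u34] at hu; omega)
  have hpos : 0 < ((B₄.powersetCard 3) \ {ℓ₁, ℓ₂, ℓ₃, ℓ₄}).card := by
    have := Finset.card_sdiff_add_card_inter (B₄.powersetCard 3) {ℓ₁, ℓ₂, ℓ₃, ℓ₄}
    omega
  obtain ⟨T, hT⟩ := Finset.card_pos.1 hpos
  rw [Finset.mem_sdiff, Finset.mem_powersetCard, Finset.mem_insert, Finset.mem_insert, Finset.mem_insert,
    Finset.mem_singleton] at hT
  push Not at hT
  refine ⟨T, hT.1.1.trans hB₄B, hT.1.2, ?_⟩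
  exact hfree T (Finset.mem_powersetCard.2 ⟨(hT.1.1.trans hB₄B).trans hB, hT.1.2⟩) hT.2.1 hT.2.2.1 hT.2.2.2.1
    hT.2.2.2.2

/-- `R₃(G)` of `K₄`: the subsets with `≥ 3` points other than the four lines. -/
theorem R3_eq_of_kFour {G ℓ₁ ℓ₂ ℓ₃ ℓ₄ : Finset α} (hG : G ∈ planes M)
    (r1 : M.eRk (ℓ₁ : Set α) = 2) (r2 : M.eRk (ℓ₂ : Set α) = 2) (r3 : M.eRk (ℓ₃ : Set α) = 2)
    (r4 : M.eRk (ℓ₄ : Set α) = 2)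
    (u12 : (ℓ₁ ∪ ℓ₂).card = 5) (u13 : (ℓ₁ ∪ ℓ₃).card = 5) (u14 : (ℓ₁ ∪ ℓ₄).card = 5) (u23 : (ℓ₂ ∪ ℓ₃).card = 5)
    (u24 : (ℓ₂ ∪ ℓ₄).card = 5) (u34 : (ℓ₃ ∪ ℓ₄).card = 5)
    (hfree : ∀ T ∈ G.powersetCard 3, T ≠ ℓ₁ → T ≠ ℓ₂ → T ≠ ℓ₃ → T ≠ ℓ₄ → M.Indep (T : Set α)) (hg : G.card = 6) :
    R3 M G = (G.powersetCard 3) \ {ℓ₁, ℓ₂, ℓ₃, ℓ₄} ∪ G.powersetCard 4 ∪ G.powersetCard 5 ∪ G.powersetCard 6 := by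
  have hG3 := (mem_planes.1 hG).2.2
  ext B
  rw [mem_R3_iff, Finset.mem_union, Finset.mem_union, Finset.mem_union, Finset.mem_sdiff, Finset.mem_insert,
    Finset.mem_insert, Finset.mem_insert, Finset.mem_singleton, Finset.mem_powersetCard, Finset.mem_powersetCard,
    Finset.mem_powersetCard, Finset.mem_powersetCard]
  constructor
  · rintro ⟨hBG, hr⟩
    have h3 := three_le_card_of_eRk_eq_three hr
    have h6 : B.card ≤ 6 := (Finset.card_le_card hBG).trans hg.le
    rcases (show B.card = 3 ∨ B.card = 4 ∨ B.card = 5 ∨ B.card = 6 by omega) with hc | hc | hc | hc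
    · left; left; left
      refine ⟨⟨hBG, hc⟩, ?_⟩
      rintro (rfl | rfl | rfl | rfl)
      · rw [r1] at hr; exact absurd hr (by decide)
      · rw [r2] at hr; exact absurd hr (by decide)
      · rw [r3] at hr; exact absurd hr (by decide)
      · rw [r4] at hr; exact absurd hr (by decide)
    · exact Or.inl (Or.inl (Or.inr ⟨hBG, hc⟩))
    · exact Or.inl (Or.inr ⟨hBG, hc⟩)
    · exact Or.inr ⟨hBG, hc⟩
  · intro hB
    have hBG : B ⊆ G := by
      rcases hB with ((h | h) | h) | h
      · exact h.1.1
      · exact h.1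
      · exact h.1
      · exact h.1
    refine ⟨hBG, le_antisymm ?_ ?_⟩
    · rw [← hG3]; exact M.eRk_mono (Finset.coe_subset.2 hBG)
    · obtain ⟨T, hTB, hT3, hind⟩ : ∃ T ⊆ B, T.card = 3 ∧ M.Indep (T : Set α) := by
        rcases hB with ((h | h) | h) | h
        · push Not at h
          exact ⟨B, Finset.Subset.refl B, h.1.2,
            hfree B (Finset.mem_powersetCard.2 h.1) h.2.1 h.2.2.1 h.2.2.2.1 h.2.2.2.2⟩
        · exact exists_indep_triple_of_four_kFour u12 u13 u14 u23 u24 u34 hfree hBG (by omega)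
        · exact exists_indep_triple_of_four_kFour u12 u13 u14 u23 u24 u34 hfree hBG (by omega)
        · exact exists_indep_triple_of_four_kFour u12 u13 u14 u23 u24 u34 hfree hBG (by omega)
      calc (3 : ℕ∞) = M.eRk (T : Set α) := by
            rw [hind.eRk_eq_encard, Set.encard_coe_eq_coe_finsetCard, hT3]; rfl
        _ ≤ M.eRk (B : Set α) := M.eRk_mono (Finset.coe_subset.2 hTB)

/-- The sum over the `b`-subsets of `K₄` of a function of `(b, λ)`, by inclusion–exclusion over the four
indicators (any three lines cover `G`). -/
theorem sum_powersetCard_kFour {G ℓ₁ ℓ₂ ℓ₃ ℓ₄ : Finset α} (s1 : ℓ₁ ⊆ G) (s2 : ℓ₂ ⊆ G) (s3 : ℓ₃ ⊆ G) (s4 : ℓ₄ ⊆ G)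
    (h1 : ℓ₁.card = 3) (h2 : ℓ₂.card = 3) (h3 : ℓ₃.card = 3) (h4 : ℓ₄.card = 3)
    (r1 : M.eRk (ℓ₁ : Set α) = 2) (r2 : M.eRk (ℓ₂ : Set α) = 2) (r3 : M.eRk (ℓ₃ : Set α) = 2)
    (r4 : M.eRk (ℓ₄ : Set α) = 2) (n12 : ℓ₁ ≠ ℓ₂) (n13 : ℓ₁ ≠ ℓ₃) (n14 : ℓ₁ ≠ ℓ₄) (n23 : ℓ₂ ≠ ℓ₃) (n24 : ℓ₂ ≠ ℓ₄)
    (n34 : ℓ₃ ≠ ℓ₄)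
    (u12 : (ℓ₁ ∪ ℓ₂).card = 5) (u13 : (ℓ₁ ∪ ℓ₃).card = 5) (u14 : (ℓ₁ ∪ ℓ₄).card = 5) (u23 : (ℓ₂ ∪ ℓ₃).card = 5)
    (u24 : (ℓ₂ ∪ ℓ₄).card = 5) (u34 : (ℓ₃ ∪ ℓ₄).card = 5)
    (t123 : ℓ₁ ∪ ℓ₂ ∪ ℓ₃ = G) (t124 : ℓ₁ ∪ ℓ₂ ∪ ℓ₄ = G) (t134 : ℓ₁ ∪ ℓ₃ ∪ ℓ₄ = G) (t234 : ℓ₂ ∪ ℓ₃ ∪ ℓ₄ = G)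
    (hg : G.card = 6)
    (hfree : ∀ T ∈ G.powersetCard 3, T ≠ ℓ₁ → T ≠ ℓ₂ → T ≠ ℓ₃ → T ≠ ℓ₄ → M.Indep (T : Set α)) (f : ℕ → ℕ → ℚ)
    (b : ℕ) :
    ∑ B ∈ G.powersetCard b, f B.card (lam3 M B) =
      (Nat.choose 6 b : ℚ) * f b 0 +
        4 * ((if 3 ≤ b then Nat.choose 3 (b - 3) else 0 : ℕ) : ℚ) * (f b 1 - f b 0) +
        6 * ((if 5 ≤ b then Nat.choose 1 (b - 5) else 0 : ℕ) : ℚ) * (f b 2 - 2 * f b 1 + f b 0) +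
        4 * ((if 6 ≤ b then Nat.choose 0 (b - 6) else 0 : ℕ) : ℚ) * (f b 3 - 3 * f b 2 + 3 * f b 1 - f b 0) +
        ((if 6 ≤ b then Nat.choose 0 (b - 6) else 0 : ℕ) : ℚ) *
          (f b 4 - 4 * f b 3 + 6 * f b 2 - 4 * f b 1 + f b 0) := by
  have t1234 : ℓ₁ ∪ ℓ₂ ∪ ℓ₃ ∪ ℓ₄ = G := by rw [t123]; exact Finset.union_eq_left.2 s4
  have hpt : ∀ B ∈ G.powersetCard b, f B.card (lam3 M B) =
      f b 0 + ((if ℓ₁ ⊆ B then (1 : ℚ) else 0) + (if ℓ₂ ⊆ B then (1 : ℚ) else 0) +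
          (if ℓ₃ ⊆ B then (1 : ℚ) else 0) + (if ℓ₄ ⊆ B then (1 : ℚ) else 0)) * (f b 1 - f b 0) +
        ((if ℓ₁ ∪ ℓ₂ ⊆ B then (1 : ℚ) else 0) + (if ℓ₁ ∪ ℓ₃ ⊆ B then (1 : ℚ) else 0) +
          (if ℓ₁ ∪ ℓ₄ ⊆ B then (1 : ℚ) else 0) + (if ℓ₂ ∪ ℓ₃ ⊆ B then (1 : ℚ) else 0) +
          (if ℓ₂ ∪ ℓ₄ ⊆ B then (1 : ℚ) else 0) + (if ℓ₃ ∪ ℓ₄ ⊆ B then (1 : ℚ) else 0)) *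
            (f b 2 - 2 * f b 1 + f b 0) +
        ((if ℓ₁ ∪ ℓ₂ ∪ ℓ₃ ⊆ B then (1 : ℚ) else 0) + (if ℓ₁ ∪ ℓ₂ ∪ ℓ₄ ⊆ B then (1 : ℚ) else 0) +
          (if ℓ₁ ∪ ℓ₃ ∪ ℓ₄ ⊆ B then (1 : ℚ) else 0) + (if ℓ₂ ∪ ℓ₃ ∪ ℓ₄ ⊆ B then (1 : ℚ) else 0)) *
            (f b 3 - 3 * f b 2 + 3 * f b 1 - f b 0) +
        (if ℓ₁ ∪ ℓ₂ ∪ ℓ₃ ∪ ℓ₄ ⊆ B then (1 : ℚ) else 0) * (f b 4 - 4 * f b 3 + 6 * f b 2 - 4 * f b 1 + f b 0) := by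
    intro B hB
    rw [Finset.mem_powersetCard] at hB
    rw [lam3_eq_of_kFour h1 h2 h3 h4 r1 r2 r3 r4 n12 n13 n14 n23 n24 n34 hfree hB.1, hB.2]
    simp only [Finset.union_subset_iff]
    by_cases a1 : ℓ₁ ⊆ B <;> by_cases a2 : ℓ₂ ⊆ B <;> by_cases a3 : ℓ₃ ⊆ B <;> by_cases a4 : ℓ₄ ⊆ B <;>
      simp [a1, a2, a3, a4] <;> ring
  rw [Finset.sum_congr rfl hpt]
  simp only [Finset.sum_add_distrib, Finset.sum_const, Finset.card_powersetCard, nsmul_eq_mul, ← Finset.sum_mul,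
    Finset.sum_boole]
  have c1 := card_filter_subset_powersetCard' s1 b
  have c2 := card_filter_subset_powersetCard' s2 b
  have c3 := card_filter_subset_powersetCard' s3 b
  have c4 := card_filter_subset_powersetCard' s4 b
  have c12 := card_filter_subset_powersetCard' (Finset.union_subset s1 s2) b
  have c13 := card_filter_subset_powersetCard' (Finset.union_subset s1 s3) b
  have c14 := card_filter_subset_powersetCard' (Finset.union_subset s1 s4) b
  have c23 := card_filter_subset_powersetCard' (Finset.union_subset s2 s3) b
  have c24 := card_filter_subset_powersetCard' (Finset.union_subset s2 s4) b
  have c34 := card_filter_subset_powersetCard' (Finset.union_subset s3 s4) b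
  have c123 := card_filter_subset_powersetCard' (t123 ▸ Finset.Subset.refl G : ℓ₁ ∪ ℓ₂ ∪ ℓ₃ ⊆ G) b
  have c124 := card_filter_subset_powersetCard' (t124 ▸ Finset.Subset.refl G : ℓ₁ ∪ ℓ₂ ∪ ℓ₄ ⊆ G) b
  have c134 := card_filter_subset_powersetCard' (t134 ▸ Finset.Subset.refl G : ℓ₁ ∪ ℓ₃ ∪ ℓ₄ ⊆ G) b
  have c234 := card_filter_subset_powersetCard' (t234 ▸ Finset.Subset.refl G : ℓ₂ ∪ ℓ₃ ∪ ℓ₄ ⊆ G) b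
  have c1234 := card_filter_subset_powersetCard' (t1234 ▸ Finset.Subset.refl G : ℓ₁ ∪ ℓ₂ ∪ ℓ₃ ∪ ℓ₄ ⊆ G) b
  have d : ∀ (ℓ : Finset α), ℓ ⊆ G → ℓ.card = 3 → (G \ ℓ).card = 3 := fun ℓ hℓ hc => by
    rw [Finset.card_sdiff, Finset.inter_eq_left.2 hℓ, hg, hc]
  have e : ∀ (ℓ ℓ' : Finset α), ℓ ⊆ G → ℓ' ⊆ G → (ℓ ∪ ℓ').card = 5 → (G \ (ℓ ∪ ℓ')).card = 1 :=
    fun ℓ ℓ' hℓ hℓ' hu => by rw [Finset.card_sdiff, Finset.inter_eq_left.2 (Finset.union_subset hℓ hℓ'), hg, hu]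
  have g3 : ∀ (S : Finset α), S = G → (G \ S).card = 0 ∧ S.card = 6 := fun S hS => by
    rw [hS, Finset.sdiff_self, Finset.card_empty, hg]; exact ⟨rfl, rfl⟩
  rw [c1, c2, c3, c4, c12, c13, c14, c23, c24, c34, c123, c124, c134, c234, c1234,
    d ℓ₁ s1 h1, d ℓ₂ s2 h2, d ℓ₃ s3 h3, d ℓ₄ s4 h4,
    e ℓ₁ ℓ₂ s1 s2 u12, e ℓ₁ ℓ₃ s1 s3 u13, e ℓ₁ ℓ₄ s1 s4 u14, e ℓ₂ ℓ₃ s2 s3 u23, e ℓ₂ ℓ₄ s2 s4 u24, e ℓ₃ ℓ₄ s3 s4 u34,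
    (g3 _ t123).1, (g3 _ t123).2, (g3 _ t124).1, (g3 _ t124).2, (g3 _ t134).1, (g3 _ t134).2,
    (g3 _ t234).1, (g3 _ t234).2, (g3 _ t1234).1, (g3 _ t1234).2,
    h1, h2, h3, h4, u12, u13, u14, u23, u24, u34, hg]
  push_cast
  ring

/-- The demand count of `K₄` at type `t`. -/
theorem card_filter_R3_kFour {G ℓ₁ ℓ₂ ℓ₃ ℓ₄ : Finset α} (hG : G ∈ planes M) (s1 : ℓ₁ ⊆ G) (s2 : ℓ₂ ⊆ G)
    (s3 : ℓ₃ ⊆ G) (s4 : ℓ₄ ⊆ G) (h1 : ℓ₁.card = 3) (h2 : ℓ₂.card = 3) (h3 : ℓ₃.card = 3) (h4 : ℓ₄.card = 3)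
    (r1 : M.eRk (ℓ₁ : Set α) = 2) (r2 : M.eRk (ℓ₂ : Set α) = 2) (r3 : M.eRk (ℓ₃ : Set α) = 2)
    (r4 : M.eRk (ℓ₄ : Set α) = 2) (n12 : ℓ₁ ≠ ℓ₂) (n13 : ℓ₁ ≠ ℓ₃) (n14 : ℓ₁ ≠ ℓ₄) (n23 : ℓ₂ ≠ ℓ₃) (n24 : ℓ₂ ≠ ℓ₄)
    (n34 : ℓ₃ ≠ ℓ₄)
    (u12 : (ℓ₁ ∪ ℓ₂).card = 5) (u13 : (ℓ₁ ∪ ℓ₃).card = 5) (u14 : (ℓ₁ ∪ ℓ₄).card = 5) (u23 : (ℓ₂ ∪ ℓ₃).card = 5)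
    (u24 : (ℓ₂ ∪ ℓ₄).card = 5) (u34 : (ℓ₃ ∪ ℓ₄).card = 5)
    (hfree : ∀ T ∈ G.powersetCard 3, T ≠ ℓ₁ → T ≠ ℓ₂ → T ≠ ℓ₃ → T ≠ ℓ₄ → M.Indep (T : Set α)) (hg : G.card = 6)
    (t : ℕ) :
    ((R3 M G).filter (fun B => B.card + t ≤ G.card)).card =
      (if 3 + t ≤ 6 then Nat.choose 6 3 - 4 else 0) + (if 4 + t ≤ 6 then Nat.choose 6 4 else 0) +
        (if 5 + t ≤ 6 then Nat.choose 6 5 else 0) + (if 6 + t ≤ 6 then Nat.choose 6 6 else 0) := by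
  have hc : ∀ k : ℕ, ((G.powersetCard k).filter (fun B => B.card + t ≤ G.card)).card =
      if k + t ≤ 6 then Nat.choose 6 k else 0 := by
    intro k
    by_cases hk : k + t ≤ 6
    · rw [if_pos hk, ← hg, ← Finset.card_powersetCard]
      congr 1
      apply Finset.filter_true_of_mem
      intro B hB
      rw [(Finset.mem_powersetCard.1 hB).2, hg]; exact hk
    · rw [if_neg hk, Finset.card_eq_zero, Finset.filter_eq_empty_iff]
      intro B hB
      rw [(Finset.mem_powersetCard.1 hB).2, hg]; exact hk
  have hquad : ({ℓ₁, ℓ₂, ℓ₃, ℓ₄} : Finset (Finset α)) ⊆ G.powersetCard 3 := by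
    intro T hT
    rw [Finset.mem_insert, Finset.mem_insert, Finset.mem_insert, Finset.mem_singleton] at hT
    rcases hT with rfl | rfl | rfl | rfl
    · exact Finset.mem_powersetCard.2 ⟨s1, h1⟩
    · exact Finset.mem_powersetCard.2 ⟨s2, h2⟩
    · exact Finset.mem_powersetCard.2 ⟨s3, h3⟩
    · exact Finset.mem_powersetCard.2 ⟨s4, h4⟩
  have hcard4 : ({ℓ₁, ℓ₂, ℓ₃, ℓ₄} : Finset (Finset α)).card = 4 := by
    rw [Finset.card_insert_of_notMem, Finset.card_insert_of_notMem, Finset.card_pair n34]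
    · rw [Finset.mem_insert, Finset.mem_singleton]; push Not; exact ⟨n23, n24⟩
    · rw [Finset.mem_insert, Finset.mem_insert, Finset.mem_singleton]; push Not; exact ⟨n12, n13, n14⟩
  have hc3 : (((G.powersetCard 3) \ {ℓ₁, ℓ₂, ℓ₃, ℓ₄}).filter (fun B => B.card + t ≤ G.card)).card =
      if 3 + t ≤ 6 then Nat.choose 6 3 - 4 else 0 := by
    by_cases hk : 3 + t ≤ 6
    · rw [if_pos hk, Finset.filter_true_of_mem (fun B hB => by
        rw [(Finset.mem_powersetCard.1 (Finset.mem_sdiff.1 hB).1).2, hg]; exact hk),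
        Finset.card_sdiff_of_subset hquad, hcard4, Finset.card_powersetCard, hg]
    · rw [if_neg hk, Finset.card_eq_zero, Finset.filter_eq_empty_iff]
      intro B hB
      rw [(Finset.mem_powersetCard.1 (Finset.mem_sdiff.1 hB).1).2, hg]; exact hk
  have hdj : ∀ i j : ℕ, i ≠ j → Disjoint ((G.powersetCard i).filter (fun B => B.card + t ≤ G.card))
      ((G.powersetCard j).filter (fun B => B.card + t ≤ G.card)) :=
    fun i j h => Finset.disjoint_filter_filter (disjoint_powersetCard_of_ne G h)
  have hdj3 : ∀ j : ℕ, 3 ≠ j →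
      Disjoint (((G.powersetCard 3) \ {ℓ₁, ℓ₂, ℓ₃, ℓ₄}).filter (fun B => B.card + t ≤ G.card))
      ((G.powersetCard j).filter (fun B => B.card + t ≤ G.card)) :=
    fun j h => Finset.disjoint_filter_filter (Finset.disjoint_of_subset_left Finset.sdiff_subset
      (disjoint_powersetCard_of_ne G h))
  rw [R3_eq_of_kFour hG r1 r2 r3 r4 u12 u13 u14 u23 u24 u34 hfree hg, Finset.filter_union, Finset.filter_union,
    Finset.filter_union, Finset.card_union_of_disjoint, Finset.card_union_of_disjoint,
    Finset.card_union_of_disjoint (hdj3 4 (by decide)), hc3, hc 4, hc 5, hc 6]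
  · rw [Finset.disjoint_union_left]; exact ⟨hdj3 5 (by decide), hdj 4 5 (by decide)⟩
  · rw [Finset.disjoint_union_left, Finset.disjoint_union_left]
    exact ⟨⟨hdj3 6 (by decide), hdj 4 6 (by decide)⟩, hdj 5 6 (by decide)⟩

/-- The cell sum of `K₄`. -/
theorem sum_R3_kFour {G ℓ₁ ℓ₂ ℓ₃ ℓ₄ : Finset α} (hG : G ∈ planes M) (s1 : ℓ₁ ⊆ G) (s2 : ℓ₂ ⊆ G) (s3 : ℓ₃ ⊆ G)
    (s4 : ℓ₄ ⊆ G) (h1 : ℓ₁.card = 3) (h2 : ℓ₂.card = 3) (h3 : ℓ₃.card = 3) (h4 : ℓ₄.card = 3)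
    (r1 : M.eRk (ℓ₁ : Set α) = 2) (r2 : M.eRk (ℓ₂ : Set α) = 2) (r3 : M.eRk (ℓ₃ : Set α) = 2)
    (r4 : M.eRk (ℓ₄ : Set α) = 2) (n12 : ℓ₁ ≠ ℓ₂) (n13 : ℓ₁ ≠ ℓ₃) (n14 : ℓ₁ ≠ ℓ₄) (n23 : ℓ₂ ≠ ℓ₃) (n24 : ℓ₂ ≠ ℓ₄)
    (n34 : ℓ₃ ≠ ℓ₄)
    (u12 : (ℓ₁ ∪ ℓ₂).card = 5) (u13 : (ℓ₁ ∪ ℓ₃).card = 5) (u14 : (ℓ₁ ∪ ℓ₄).card = 5) (u23 : (ℓ₂ ∪ ℓ₃).card = 5)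
    (u24 : (ℓ₂ ∪ ℓ₄).card = 5) (u34 : (ℓ₃ ∪ ℓ₄).card = 5)
    (t123 : ℓ₁ ∪ ℓ₂ ∪ ℓ₃ = G) (t124 : ℓ₁ ∪ ℓ₂ ∪ ℓ₄ = G) (t134 : ℓ₁ ∪ ℓ₃ ∪ ℓ₄ = G) (t234 : ℓ₂ ∪ ℓ₃ ∪ ℓ₄ = G)
    (hg : G.card = 6)
    (hfree : ∀ T ∈ G.powersetCard 3, T ≠ ℓ₁ → T ≠ ℓ₂ → T ≠ ℓ₃ → T ≠ ℓ₄ → M.Indep (T : Set α)) (f : ℕ → ℕ → ℚ) :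
    ∑ B ∈ R3 M G, f B.card (lam3 M B) =
      16 * f 3 0 + (15 * f 4 0 + 12 * (f 4 1 - f 4 0)) +
      (6 * f 5 0 + 12 * (f 5 1 - f 5 0) + 6 * (f 5 2 - 2 * f 5 1 + f 5 0)) +
      (f 6 0 + 4 * (f 6 1 - f 6 0) + 6 * (f 6 2 - 2 * f 6 1 + f 6 0) + 4 * (f 6 3 - 3 * f 6 2 + 3 * f 6 1 - f 6 0) +
        (f 6 4 - 4 * f 6 3 + 6 * f 6 2 - 4 * f 6 1 + f 6 0)) := by
  have hdj : ∀ i j : ℕ, i ≠ j → Disjoint (G.powersetCard i) (G.powersetCard j) := fun i j h => disjoint_powersetCard_of_ne G h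
  have hdj3 : ∀ j : ℕ, 3 ≠ j → Disjoint ((G.powersetCard 3) \ {ℓ₁, ℓ₂, ℓ₃, ℓ₄}) (G.powersetCard j) :=
    fun j h => Finset.disjoint_of_subset_left Finset.sdiff_subset (disjoint_powersetCard_of_ne G h)
  rw [R3_eq_of_kFour hG r1 r2 r3 r4 u12 u13 u14 u23 u24 u34 hfree hg, Finset.sum_union, Finset.sum_union,
    Finset.sum_union (hdj3 4 (by decide))]
  · have hquad : ({ℓ₁, ℓ₂, ℓ₃, ℓ₄} : Finset (Finset α)) ⊆ G.powersetCard 3 := by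
      intro T hT
      rw [Finset.mem_insert, Finset.mem_insert, Finset.mem_insert, Finset.mem_singleton] at hT
      rcases hT with rfl | rfl | rfl | rfl
      · exact Finset.mem_powersetCard.2 ⟨s1, h1⟩
      · exact Finset.mem_powersetCard.2 ⟨s2, h2⟩
      · exact Finset.mem_powersetCard.2 ⟨s3, h3⟩
      · exact Finset.mem_powersetCard.2 ⟨s4, h4⟩
    have hcard4 : ({ℓ₁, ℓ₂, ℓ₃, ℓ₄} : Finset (Finset α)).card = 4 := by
      rw [Finset.card_insert_of_notMem, Finset.card_insert_of_notMem, Finset.card_pair n34]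
      · rw [Finset.mem_insert, Finset.mem_singleton]; push Not; exact ⟨n23, n24⟩
      · rw [Finset.mem_insert, Finset.mem_insert, Finset.mem_singleton]; push Not; exact ⟨n12, n13, n14⟩
    have hsum3 : ∑ B ∈ (G.powersetCard 3) \ {ℓ₁, ℓ₂, ℓ₃, ℓ₄}, f B.card (lam3 M B) = 16 * f 3 0 := by
      have : ∀ B ∈ (G.powersetCard 3) \ {ℓ₁, ℓ₂, ℓ₃, ℓ₄}, f B.card (lam3 M B) = f 3 0 := by
        intro B hB
        rw [Finset.mem_sdiff, Finset.mem_insert, Finset.mem_insert, Finset.mem_insert, Finset.mem_singleton] at hB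
        push Not at hB
        have hB' := Finset.mem_powersetCard.1 hB.1
        rw [lam3_eq_of_kFour h1 h2 h3 h4 r1 r2 r3 r4 n12 n13 n14 n23 n24 n34 hfree hB'.1, hB'.2, if_neg, if_neg,
          if_neg, if_neg]
        · intro h; exact hB.2.2.2.2 (Finset.eq_of_subset_of_card_le h (by rw [hB'.2, h4])).symm
        · intro h; exact hB.2.2.2.1 (Finset.eq_of_subset_of_card_le h (by rw [hB'.2, h3])).symm
        · intro h; exact hB.2.2.1 (Finset.eq_of_subset_of_card_le h (by rw [hB'.2, h2])).symm
        · intro h; exact hB.2.1 (Finset.eq_of_subset_of_card_le h (by rw [hB'.2, h1])).symm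
      rw [Finset.sum_congr rfl this, Finset.sum_const, Finset.card_sdiff_of_subset hquad, hcard4,
        Finset.card_powersetCard, hg, nsmul_eq_mul]
      norm_num [Nat.choose]
    rw [hsum3, sum_powersetCard_kFour s1 s2 s3 s4 h1 h2 h3 h4 r1 r2 r3 r4 n12 n13 n14 n23 n24 n34 u12 u13 u14 u23
        u24 u34 t123 t124 t134 t234 hg hfree f 4,
      sum_powersetCard_kFour s1 s2 s3 s4 h1 h2 h3 h4 r1 r2 r3 r4 n12 n13 n14 n23 n24 n34 u12 u13 u14 u23
        u24 u34 t123 t124 t134 t234 hg hfree f 5,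
      sum_powersetCard_kFour s1 s2 s3 s4 h1 h2 h3 h4 r1 r2 r3 r4 n12 n13 n14 n23 n24 n34 u12 u13 u14 u23
        u24 u34 t123 t124 t134 t234 hg hfree f 6]
    norm_num [Nat.choose]
  · rw [Finset.disjoint_union_left]; exact ⟨hdj3 5 (by decide), hdj 4 5 (by decide)⟩
  · rw [Finset.disjoint_union_left, Finset.disjoint_union_left]
    exact ⟨⟨hdj3 6 (by decide), hdj 4 6 (by decide)⟩, hdj 5 6 (by decide)⟩

/-- **`K₄` at `t = 1, 2, 3`.** -/
theorem perPlane_kFour (hs : Simple M) (hrank : M.eRank = 7) {G ℓ₁ ℓ₂ ℓ₃ ℓ₄ : Finset α} (hG : G ∈ planes M)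
    (s1 : ℓ₁ ⊆ G) (s2 : ℓ₂ ⊆ G) (s3 : ℓ₃ ⊆ G) (s4 : ℓ₄ ⊆ G) (h1 : ℓ₁.card = 3) (h2 : ℓ₂.card = 3)
    (h3 : ℓ₃.card = 3) (h4 : ℓ₄.card = 3)
    (r1 : M.eRk (ℓ₁ : Set α) = 2) (r2 : M.eRk (ℓ₂ : Set α) = 2) (r3 : M.eRk (ℓ₃ : Set α) = 2)
    (r4 : M.eRk (ℓ₄ : Set α) = 2) (n12 : ℓ₁ ≠ ℓ₂) (n13 : ℓ₁ ≠ ℓ₃) (n14 : ℓ₁ ≠ ℓ₄) (n23 : ℓ₂ ≠ ℓ₃) (n24 : ℓ₂ ≠ ℓ₄)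
    (n34 : ℓ₃ ≠ ℓ₄)
    (u12 : (ℓ₁ ∪ ℓ₂).card = 5) (u13 : (ℓ₁ ∪ ℓ₃).card = 5) (u14 : (ℓ₁ ∪ ℓ₄).card = 5) (u23 : (ℓ₂ ∪ ℓ₃).card = 5)
    (u24 : (ℓ₂ ∪ ℓ₄).card = 5) (u34 : (ℓ₃ ∪ ℓ₄).card = 5)
    (t123 : ℓ₁ ∪ ℓ₂ ∪ ℓ₃ = G) (t124 : ℓ₁ ∪ ℓ₂ ∪ ℓ₄ = G) (t134 : ℓ₁ ∪ ℓ₃ ∪ ℓ₄ = G) (t234 : ℓ₂ ∪ ℓ₃ ∪ ℓ₄ = G)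
    (hg : G.card = 6)
    (hfree : ∀ T ∈ G.powersetCard 3, T ≠ ℓ₁ → T ≠ ℓ₂ → T ≠ ℓ₃ → T ≠ ℓ₄ → M.Indep (T : Set α))
    {t : ℕ} (ht1 : 1 ≤ t) (ht3 : t ≤ 3)
    (ht : M.eRk ((gr M \ G : Finset α) : Set α) + (t : ℕ∞) = 7)
    (hno4 : ∀ L ∈ lines M, (L ∩ G).card ≤ 3)
    (hdem : (UqG M 7 3 G).card ≤ ((R3 M G).filter (fun B => B.card + t ≤ G.card)).card) :
    (28 / 5 : ℚ) * ((UqG M 7 3 G).card : ℚ) ≤ ∑ S ∈ Yq M 7 3, fRule M G S / D M S := by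
  have hcard := card_filter_R3_kFour hG s1 s2 s3 s4 h1 h2 h3 h4 r1 r2 r3 r4 n12 n13 n14 n23 n24 n34 u12 u13 u14
    u23 u24 u34 hfree hg t
  rcases (show t = 1 ∨ t = 2 ∨ t = 3 by omega) with rfl | rfl | rfl
  · apply perPlane_t1_of_cell hs hrank hG ht hno4 hdem
    rw [sum_R3_kFour hG s1 s2 s3 s4 h1 h2 h3 h4 r1 r2 r3 r4 n12 n13 n14 n23 n24 n34 u12 u13 u14 u23 u24 u34
      t123 t124 t134 t234 hg hfree Cells.vOne, hcard]
    norm_num [Nat.choose]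
    linarith [Cells.cell_kFour_t1]
  · apply perPlane_t2_of_cell hs hrank hG ht hno4 hdem
    rw [sum_R3_kFour hG s1 s2 s3 s4 h1 h2 h3 h4 r1 r2 r3 r4 n12 n13 n14 n23 n24 n34 u12 u13 u14 u23 u24 u34
      t123 t124 t134 t234 hg hfree Cells.vTwo, hcard]
    norm_num [Nat.choose]
    linarith [Cells.cell_kFour_t2]
  · apply perPlane_t3_of_cell hs hrank hG ht hno4 hdem
    rw [sum_R3_kFour hG s1 s2 s3 s4 h1 h2 h3 h4 r1 r2 r3 r4 n12 n13 n14 n23 n24 n34 u12 u13 u14 u23 u24 u34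
      t123 t124 t134 t234 hg hfree Cells.vThree, hcard]
    norm_num [Nat.choose]
    linarith [Cells.cell_kFour_t3]

end SevenThree

end PercRepro
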